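import Literature.Analysis.Calculus.EvolutionDerivBoundsGraded
import Mathlib.Analysis.SpecialFunctions.Pow.Deriv
import Mathlib.Analysis.SpecialFunctions.Pow.Continuity
import HarnessLib

/-!
# Spatial derivative bounds by integration in time with an integrable rate

Analysis/Calculus support file (everything proved, no named fact), the integrable-rate companion
of `spatiallyBddUpTo_of_dT` (`EvolutionDerivBoundsGraded.lean`). There, on a cylinder
`B × (t₁, T)`, bounds on `∂ʲ_y ∂ₜ u` give bounds on `∂ʲ_y u` by the mean value inequality. For the
NORMALISED Ricci flow near a round singular time (Hamilton 1982, §14, Lemma 14.2 and §17,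
Cor. 17.10: the metrics `g̃(t) = g(t)/(T − t)` converge in `C^∞` as `t ↑ T`) the time derivatives
are not bounded but only INTEGRABLE: `‖∂ʲ_y ∂ₜ u(y, t)‖ ≤ C (T − t)^{δ−1}` with `δ > 0`. Then
`∂ʲ_y u` is still bounded on the cylinder, and moreover uniformly Cauchy as `t ↑ T`:
`‖∂ʲ_y u(y, t') − ∂ʲ_y u(y, t)‖ ≤ (C/δ)((T − t)^δ − (T − t')^δ)` for `t ≤ t'` (Hamilton 1982,
Lemma 14.2: "if `∫ |∂ₜ f| dt ≤ C` then `f` converges uniformly as `t → T`"). This file supplies: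

* `dYk_tsmul`, `SpatiallyBddUpTo.tsmul`, `SpatiallyBddUpTo.rpow_smul` — a factor depending on
  time only passes through the spatial derivatives; multiplication by such a factor, smooth and
  bounded at the times of `Ω` (e.g. `(T − t)^p`, `p ≥ 0`, on times in `(t₁, T)`), preserves
  `SpatiallyBddUpTo`; `SpatiallyBddUpTo.rpow_neg_smul_mono` — a decay weight `(T − t)^{−δ}` may
  be lowered to `(T − t)^{−δ'}`, `0 ≤ δ' ≤ δ`.
* `norm_dYk_sub_le_of_dT_rpow` — the modulus `(C/δ)((T − t)^δ − (T − t')^δ)` above, from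
  `∂ₜ u = (T − t)^{δ−1} v` with `v` bounded up to order `m`
  (`image_norm_le_of_norm_deriv_right_le_deriv_boundary'` with the boundary function
  `s ↦ (C/δ)((T − t)^δ − (T − s)^δ)`).
* `spatiallyBddUpTo_of_dT_rpow` — boundedness up to order `m` on `B × (t₁, T)`
  (`B ⊆ K ⊆ B₀`, `K` compact, `u` smooth on `B₀ × (t₁, T)`), and
  `dYk_cauchy_of_dT_rpow` — the uniform Cauchy property as `t ↑ T` in `ε`-form.

## References

* R. S. Hamilton, *Three-manifolds with positive Ricci curvature*, J. Differential Geom. 17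
  (1982) 255–306, §14, Lemma 14.2; §17, Cor. 17.10. [Hamilton1982]
* P. Topping, *Lectures on the Ricci flow*, LMS Lecture Note Series 325, CUP 2006, proof of
  Thm. 5.3.1, pp. 47–48. [Topping2006]
* B. Chow, D. Knopf, *The Ricci flow: an introduction*, AMS 2004, §6.7. [ChowKnopf2004]
-/

noncomputable section

open Set Filter Function Metric
open scoped Topology ContDiff

namespace Literature.Analysis.Calculus

-- operator spaces of iterated derivatives
set_option maxSynthPendingDepth 3

universe u v

variable {E : Type u} [NormedAddCommGroup E] [NormedSpace ℝ E]
  {W : Type v} [NormedAddCommGroup W] [NormedSpace ℝ W]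

/-! ### Factors depending on time only -/

section TimeFactor

variable {Ω : Set (E × ℝ)} {u : E × ℝ → W} {m : ℕ}

/-- `∂ʲ_y (f(t) u) = f(t) ∂ʲ_y u`: a factor depending on time only passes through the spatial
derivatives. [folklore] -/
theorem dYk_tsmul (f : ℝ → ℝ) (j : ℕ) {q : E × ℝ}
    (hu : ContDiffAt ℝ ∞ (fun y ↦ u (y, q.2)) q.1) :
    dYk j (fun p ↦ f p.2 • u p) q = f q.2 • dYk j u q := by
  show iteratedFDeriv ℝ j (fun y ↦ f q.2 • u (y, q.2)) q.1 =
    f q.2 • iteratedFDeriv ℝ j (fun y ↦ u (y, q.2)) q.1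
  exact iteratedFDeriv_const_smul_apply' (a := f q.2) (hu.of_le (by exact_mod_cast le_top))

/-- `∂_y (f(t) u) = f(t) ∂_y u`. [folklore] -/
theorem dY_tsmul (f : ℝ → ℝ) {q : E × ℝ} (hu : DifferentiableAt ℝ (fun y ↦ u (y, q.2)) q.1) :
    dY (fun p ↦ f p.2 • u p) q = f q.2 • dY u q := by
  show fderiv ℝ (fun y ↦ f q.2 • u (y, q.2)) q.1 = f q.2 • fderiv ℝ (fun y ↦ u (y, q.2)) q.1
  exact fderiv_fun_const_smul hu (f q.2)

/-- **A time-only factor, smooth and bounded at the times of `Ω`, preserves `SpatiallyBddUpTo`.**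
[folklore] -/
theorem SpatiallyBddUpTo.tsmul (hΩ : IsOpen Ω) (hu : SpatiallyBddUpTo Ω m u) {f : ℝ → ℝ}
    (hf : ∀ q ∈ Ω, ContDiffAt ℝ ∞ f q.2) {C : ℝ} (hC : ∀ q ∈ Ω, |f q.2| ≤ C) :
    SpatiallyBddUpTo Ω m (fun p ↦ f p.2 • u p) := by
  refine ⟨?_, fun j hj ↦ ?_⟩
  · have h1 : ContDiffOn ℝ ∞ (fun p : E × ℝ ↦ f p.2) Ω := fun q hq ↦
      ((hf q hq).comp q contDiffAt_snd).contDiffWithinAt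
    exact h1.smul hu.contDiffOn
  · obtain ⟨D, hD⟩ := hu.isBounded j hj
    refine ⟨C * D, fun q hq ↦ ?_⟩
    rw [dYk_tsmul f j (contDiffAt_sliceY hΩ hu.contDiffOn hq), norm_smul, Real.norm_eq_abs]
    exact mul_le_mul (hC q hq) (hD q hq) (norm_nonneg _) ((abs_nonneg _).trans (hC q hq))

/-- The powers `(T − t)^p` are smooth at times `t < T`. [folklore] -/
theorem contDiffAt_rpow_sub {T t : ℝ} (ht : t < T) (p : ℝ) :
    ContDiffAt ℝ ∞ (fun s : ℝ ↦ (T - s) ^ p) t :=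
  (contDiffAt_const.sub contDiffAt_id).rpow_const_of_ne (sub_ne_zero.2 ht.ne')

/-- **Multiplication by `(T − t)^p`, `p ≥ 0`, on a set of times in `(t₁, T)`** preserves
`SpatiallyBddUpTo` (the factor is smooth and bounded by `(T − t₁)^p` there). [folklore] -/
theorem SpatiallyBddUpTo.rpow_smul (hΩ : IsOpen Ω) (hu : SpatiallyBddUpTo Ω m u) {T t₁ p : ℝ}
    (hp : 0 ≤ p) (ht : ∀ q ∈ Ω, q.2 ∈ Ioo t₁ T) :
    SpatiallyBddUpTo Ω m (fun q ↦ (T - q.2) ^ p • u q) :=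
  hu.tsmul hΩ (fun q hq ↦ contDiffAt_rpow_sub (ht q hq).2 p) (C := (T - t₁) ^ p) fun q hq ↦ by
    rw [abs_of_nonneg (Real.rpow_nonneg (sub_nonneg.2 (ht q hq).2.le) p)]
    exact Real.rpow_le_rpow (sub_nonneg.2 (ht q hq).2.le) (by linarith [(ht q hq).1]) hp

/-- **Lowering a decay weight**: if `(T − t)^{−δ} u` is bounded up to order `m` on a set of
times in `(t₁, T)`, so is `(T − t)^{−δ'} u` for `0 ≤ δ' ≤ δ`
(`(T − t)^{−δ'} = (T − t)^{δ − δ'} (T − t)^{−δ}`). [folklore] -/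
theorem SpatiallyBddUpTo.rpow_neg_smul_mono (hΩ : IsOpen Ω) {T t₁ δ δ' : ℝ}
    (hu : SpatiallyBddUpTo Ω m (fun q ↦ (T - q.2) ^ (-δ) • u q)) (hδ' : δ' ≤ δ)
    (ht : ∀ q ∈ Ω, q.2 ∈ Ioo t₁ T) :
    SpatiallyBddUpTo Ω m (fun q ↦ (T - q.2) ^ (-δ') • u q) := by
  refine (hu.rpow_smul hΩ (sub_nonneg.2 hδ') ht).congr hΩ fun q hq ↦ ?_
  have hpos : 0 < T - q.2 := sub_pos.2 (ht q hq).2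
  simp only [smul_smul, ← Real.rpow_add hpos]
  congr 1
  ring_nf

end TimeFactor

/-! ### Integration in time with the rate `(T − t)^{δ−1}` -/

section Integrable

variable {B₀ B : Set E} {t₁ T δ : ℝ} {u v : E × ℝ → W} {m : ℕ}

/-- **The modulus in time from an integrable rate** (Hamilton 1982, §14, Lemma 14.2: "if
`∫|∂ₜf| ≤ C` then `f` converges uniformly"): let `u` be `C^∞` on the open cylinder
`B₀ × (t₁, T)`, `B ⊆ B₀`, `δ > 0`, and `∂ₜ u = (T − t)^{δ−1} v` on `B × (t₁, T)` with `v` bounded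
up to order `m` there. Then for `j ≤ m` there is `C` with
`‖∂ʲ_y u(y, t') − ∂ʲ_y u(y, t)‖ ≤ C ((T − t)^δ − (T − t')^δ)` for `y ∈ B`, `t₁ < t ≤ t' < T`
(`∂ₜ ∂ʲ_y u = (T − t)^{δ−1} ∂ʲ_y v` and the boundary-function form of the mean value inequality).
[cite: Hamilton1982, §14, Lemma 14.2] -/
theorem norm_dYk_sub_le_of_dT_rpow (hB₀ : IsOpen B₀) (hB : IsOpen B) (hBB₀ : B ⊆ B₀) (hδ : 0 < δ)
    (hu : ContDiffOn ℝ ∞ u (B₀ ×ˢ Ioo t₁ T)) (hv : SpatiallyBddUpTo (B ×ˢ Ioo t₁ T) m v)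
    (heq : EqOn (dT u) (fun q ↦ (T - q.2) ^ (δ - 1) • v q) (B ×ˢ Ioo t₁ T)) :
    ∀ j ≤ m, ∃ C : ℝ, 0 ≤ C ∧ ∀ y ∈ B, ∀ t ∈ Ioo t₁ T, ∀ t' ∈ Ioo t₁ T, t ≤ t' →
      ‖dYk j u (y, t') - dYk j u (y, t)‖ ≤ C * ((T - t) ^ δ - (T - t') ^ δ) := by
  intro j hj
  have hΩ₀ : IsOpen (B₀ ×ˢ Ioo t₁ T) := hB₀.prod isOpen_Ioo
  have hΩ : IsOpen (B ×ˢ Ioo t₁ T) := hB.prod isOpen_Ioo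
  obtain ⟨C, hC⟩ := hv.isBounded j hj
  refine ⟨|C| / δ, by positivity, fun y hy t ht t' ht' htt' ↦ ?_⟩
  have hyB₀ : y ∈ B₀ := hBB₀ hy
  -- the path `s ↦ ∂ʲ_y u (y, s)` and its derivative `(T − s)^{δ−1} ∂ʲ_y v (y, s)`
  have hpath : ∀ s ∈ Ioo t₁ T,
      HasDerivAt (fun s' ↦ dYk j u (y, s')) ((T - s) ^ (δ - 1) • dYk j v (y, s)) s := by
    intro s hs
    have hd : DifferentiableAt ℝ (fun s' ↦ dYk j u (y, s')) s :=
      (contDiffAt_sliceT (q := (y, s)) hΩ₀ (contDiffOn_dYk hΩ₀ hu j) ⟨hyB₀, hs⟩).differentiableAt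
        (by simp)
    have h1 : dT (dYk j u) (y, s) = (T - s) ^ (δ - 1) • dYk j v (y, s) := by
      rw [dT_dYk (q := (y, s)) hΩ₀ hu j ⟨hyB₀, hs⟩, dYk_congr hΩ heq (q := (y, s)) ⟨hy, hs⟩ j]
      exact dYk_tsmul (u := v) (fun r ↦ (T - r) ^ (δ - 1)) j
        (contDiffAt_sliceY (q := (y, s)) hΩ hv.contDiffOn ⟨hy, hs⟩)
    rw [← h1]
    exact hd.hasDerivAt
  -- the mean value inequality with the boundary function `s ↦ (|C|/δ)((T−t)^δ − (T−s)^δ)`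
  have hIcc : Icc t t' ⊆ Ioo t₁ T := fun s hs ↦ ⟨ht.1.trans_le hs.1, hs.2.trans_lt ht'.2⟩
  set f : ℝ → (E [×j]→L[ℝ] W) := fun s ↦ dYk j u (y, s) - dYk j u (y, t) with hf
  set Bf : ℝ → ℝ := fun s ↦ |C| / δ * ((T - t) ^ δ - (T - s) ^ δ) with hBf
  have hfc : ContinuousOn f (Icc t t') := fun s hs ↦
    (((hpath s (hIcc hs)).continuousAt.sub continuousAt_const).continuousWithinAt :)
  have hf' : ∀ s ∈ Ico t t', HasDerivWithinAt f ((T - s) ^ (δ - 1) • dYk j v (y, s)) (Ici s) s :=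
    fun s hs ↦ ((hpath s (hIcc (Ico_subset_Icc_self hs))).sub_const _).hasDerivWithinAt
  have hBd : ∀ s, s < T → HasDerivAt Bf (|C| * (T - s) ^ (δ - 1)) s := by
    intro s hs
    have h1 : HasDerivAt (fun s' : ℝ ↦ (T - s') ^ δ) ((0 - 1) * δ * (T - s) ^ (δ - 1)) s :=
      ((hasDerivAt_const s T).sub (hasDerivAt_id s)).rpow_const (Or.inl (sub_ne_zero.2 hs.ne'))
    have h2 := (h1.const_sub ((T - t) ^ δ)).const_mul (|C| / δ)
    refine h2.congr_deriv ?_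
    calc |C| / δ * (-((0 - 1) * δ * (T - s) ^ (δ - 1))) = |C| / δ * δ * (T - s) ^ (δ - 1) := by
          ring
      _ = |C| * (T - s) ^ (δ - 1) := by rw [div_mul_cancel₀ |C| hδ.ne']
  have hBc : ContinuousOn Bf (Icc t t') := fun s hs ↦
    (hBd s (hIcc hs).2).continuousAt.continuousWithinAt
  have hB' : ∀ s ∈ Ico t t', HasDerivWithinAt Bf (|C| * (T - s) ^ (δ - 1)) (Ici s) s :=
    fun s hs ↦ (hBd s (hIcc (Ico_subset_Icc_self hs)).2).hasDerivWithinAt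
  have ha : ‖f t‖ ≤ Bf t := by simp [hf, hBf]
  have hbound : ∀ s ∈ Ico t t', ‖(T - s) ^ (δ - 1) • dYk j v (y, s)‖ ≤ |C| * (T - s) ^ (δ - 1) := by
    intro s hs
    have hs' : s ∈ Ioo t₁ T := hIcc (Ico_subset_Icc_self hs)
    have hpos : 0 ≤ (T - s) ^ (δ - 1) := Real.rpow_nonneg (sub_nonneg.2 hs'.2.le) _
    rw [norm_smul, Real.norm_eq_abs, abs_of_nonneg hpos, mul_comm]
    exact mul_le_mul_of_nonneg_right ((hC (y, s) ⟨hy, hs'⟩).trans (le_abs_self C)) hpos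
  have key := image_norm_le_of_norm_deriv_right_le_deriv_boundary' hfc hf' ha hBc hB' hbound
    (right_mem_Icc.2 htt')
  simpa [hf, hBf] using key

/-- **Bounds by integration in time with an integrable rate**: under the hypotheses of
`norm_dYk_sub_le_of_dT_rpow`, with `B ⊆ K ⊆ B₀`, `K` compact and `t₁ < T`, the spatial
derivatives of order `≤ m` of `u` are bounded on `B × (t₁, T)` (the modulus from the reference
time `t₂ = (t₁ + T)/2`, where `∂ʲ_y u(·, t₂)` is bounded on `K`, `exists_forall_norm_dYk_slice_le`).
[cite: Hamilton1982, §14, Lemma 14.2] -/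
theorem spatiallyBddUpTo_of_dT_rpow (hB₀ : IsOpen B₀) (hB : IsOpen B) {K : Set E} (hK : IsCompact K)
    (hBK : B ⊆ K) (hKB₀ : K ⊆ B₀) (ht₁ : t₁ < T) (hδ : 0 < δ)
    (hu : ContDiffOn ℝ ∞ u (B₀ ×ˢ Ioo t₁ T)) (hv : SpatiallyBddUpTo (B ×ˢ Ioo t₁ T) m v)
    (heq : EqOn (dT u) (fun q ↦ (T - q.2) ^ (δ - 1) • v q) (B ×ˢ Ioo t₁ T)) :
    SpatiallyBddUpTo (B ×ˢ Ioo t₁ T) m u := by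
  have ht₂ : (t₁ + T) / 2 ∈ Ioo t₁ T := by constructor <;> linarith
  refine ⟨hu.mono (prod_mono (hBK.trans hKB₀) Subset.rfl), fun j hj ↦ ?_⟩
  obtain ⟨C, hC0, hC⟩ := norm_dYk_sub_le_of_dT_rpow hB₀ hB (hBK.trans hKB₀) hδ hu hv heq j hj
  obtain ⟨C₀, hC₀⟩ := exists_forall_norm_dYk_slice_le hB₀ hK hKB₀ ht₂ hu j
  have hTpow : 0 ≤ (T - t₁) ^ δ := Real.rpow_nonneg (sub_nonneg.2 ht₁.le) δ
  refine ⟨C₀ + C * (T - t₁) ^ δ, ?_⟩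
  rintro ⟨y, t⟩ ⟨hy, ht⟩
  have h0 : ‖dYk j u (y, (t₁ + T) / 2)‖ ≤ C₀ := hC₀ y (hBK hy)
  -- the modulus between `t` and `t₂`, in either order, is at most `C (T − t₁)^δ`
  have hmod : ‖dYk j u (y, t) - dYk j u (y, (t₁ + T) / 2)‖ ≤ C * (T - t₁) ^ δ := by
    have hle : ∀ s ∈ Ioo t₁ T, ∀ s' ∈ Ioo t₁ T,
        (T - s) ^ δ - (T - s') ^ δ ≤ (T - t₁) ^ δ := fun s hs s' hs' ↦ by
      have h1 : (T - s) ^ δ ≤ (T - t₁) ^ δ :=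
        Real.rpow_le_rpow (sub_nonneg.2 hs.2.le) (by linarith [hs.1]) hδ.le
      linarith [Real.rpow_nonneg (sub_nonneg.2 hs'.2.le) δ]
    rcases le_total t ((t₁ + T) / 2) with h | h
    · rw [norm_sub_rev]
      exact (hC y hy t ht _ ht₂ h).trans (mul_le_mul_of_nonneg_left (hle t ht _ ht₂) hC0)
    · exact (hC y hy _ ht₂ t ht h).trans (mul_le_mul_of_nonneg_left (hle _ ht₂ t ht) hC0)
  calc ‖dYk j u (y, t)‖
      ≤ ‖dYk j u (y, (t₁ + T) / 2)‖ + ‖dYk j u (y, t) - dYk j u (y, (t₁ + T) / 2)‖ :=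
        norm_le_insert' _ _
    _ ≤ C₀ + C * (T - t₁) ^ δ := add_le_add h0 hmod

/-- **The uniform Cauchy property as `t ↑ T` from an integrable rate**: under the hypotheses of
`norm_dYk_sub_le_of_dT_rpow`, for `j ≤ m` and `ε > 0` there is `t₂ ∈ (t₁, T)` with
`‖∂ʲ_y u(y, t) − ∂ʲ_y u(y, t')‖ ≤ ε` for all `y ∈ B` and `t, t' ∈ [t₂, T)` (the modulus is at
most `C (T − t₂)^δ → 0`). [cite: Hamilton1982, §14, Lemma 14.2] -/
theorem dYk_cauchy_of_dT_rpow (hB₀ : IsOpen B₀) (hB : IsOpen B) (hBB₀ : B ⊆ B₀) (ht₁ : t₁ < T)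
    (hδ : 0 < δ) (hu : ContDiffOn ℝ ∞ u (B₀ ×ˢ Ioo t₁ T))
    (hv : SpatiallyBddUpTo (B ×ˢ Ioo t₁ T) m v)
    (heq : EqOn (dT u) (fun q ↦ (T - q.2) ^ (δ - 1) • v q) (B ×ˢ Ioo t₁ T)) :
    ∀ j ≤ m, ∀ ε > (0 : ℝ), ∃ t₂ ∈ Ioo t₁ T, ∀ y ∈ B, ∀ t ∈ Ico t₂ T, ∀ t' ∈ Ico t₂ T,
      ‖dYk j u (y, t) - dYk j u (y, t')‖ ≤ ε := by
  intro j hj ε hε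
  obtain ⟨C, hC0, hC⟩ := norm_dYk_sub_le_of_dT_rpow hB₀ hB hBB₀ hδ hu hv heq j hj
  -- `C (T − s)^δ → 0` as `s → T`, so it is `≤ ε` at some `t₂ ∈ (t₁, T)`
  have hlim : Tendsto (fun s : ℝ ↦ C * (T - s) ^ δ) (𝓝 T) (𝓝 0) := by
    have h1 : Tendsto (fun s : ℝ ↦ T - s) (𝓝 T) (𝓝 0) := by
      have h := (tendsto_const_nhds : Tendsto (fun _ : ℝ ↦ T) (𝓝 T) (𝓝 T)).sub tendsto_id
      simpa using h
    have h2 : Tendsto (fun x : ℝ ↦ x ^ δ) (𝓝 0) (𝓝 0) := by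
      simpa [Real.zero_rpow hδ.ne'] using (Real.continuousAt_rpow_const 0 δ (Or.inr hδ.le)).tendsto
    simpa using (h2.comp h1).const_mul C
  have hev : ∀ᶠ s in 𝓝 T, C * (T - s) ^ δ ≤ ε :=
    (hlim.eventually (Iic_mem_nhds hε)).mono fun s hs ↦ hs
  have hev' : ∀ᶠ s in 𝓝[<] T, C * (T - s) ^ δ ≤ ε ∧ s ∈ Ioo t₁ T :=
    (hev.filter_mono nhdsWithin_le_nhds).and (Ioo_mem_nhdsLT ht₁)
  obtain ⟨t₂, ht₂ε, ht₂⟩ := hev'.exists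
  refine ⟨t₂, ht₂, fun y hy t ht t' ht' ↦ ?_⟩
  have hmono : ∀ s ∈ Ico t₂ T, C * (T - s) ^ δ ≤ ε := fun s hs ↦ by
    refine le_trans (mul_le_mul_of_nonneg_left ?_ hC0) ht₂ε
    exact Real.rpow_le_rpow (sub_nonneg.2 hs.2.le) (by linarith [hs.1]) hδ.le
  have htI : t ∈ Ioo t₁ T := ⟨ht₂.1.trans_le ht.1, ht.2⟩
  have ht'I : t' ∈ Ioo t₁ T := ⟨ht₂.1.trans_le ht'.1, ht'.2⟩
  rcases le_total t t' with h | h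
  · rw [norm_sub_rev]
    refine (hC y hy t htI t' ht'I h).trans (le_trans ?_ (hmono t ht))
    have := Real.rpow_nonneg (sub_nonneg.2 ht'I.2.le) δ
    nlinarith
  · refine (hC y hy t' ht'I t htI h).trans (le_trans ?_ (hmono t' ht'))
    have := Real.rpow_nonneg (sub_nonneg.2 htI.2.le) δ
    nlinarith

end Integrable

end Literature.Analysis.Calculus

end
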